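import Literature.NumberTheory.EllipticCurves.ZpExtensionEisensteinLocalOrdinaryReadoutProofs
import HarnessLib

/-!
# The readout of Howard's ORDINARY condition at `v ∣ p` lands in Greenberg's STRICT condition over `K_∞`,
# hence (Greenberg Prop. 2.4) in the local condition of `Sel_{p^∞}(E/K_∞)` (proofs file, part 2 of the `v ∣ p` clause)

Topic `NumberTheory/EllipticCurves` (cell `pub/bsd-print-x9`, blueprint HOME/p2/S1-DISCRETE-CONTROL §2 «v ∣ p» = file F7;
sequel to `ZpExtensionEisensteinLocalOrdinaryReadoutProofs` (cores read out modulo `C_v`; descent of the saturation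
exponent), `ZpExtensionEisensteinTowerReadoutBijectiveProofs` (the readout `H¹(K, A_𝔮) → H¹(K_∞, E[p^∞])`) and
`Greenberg1999/KummerImageGoodOrdinaryNumberField` (the cite-only leaf (CG) = Greenberg LNM 1716 Prop. 2.4, F7 projection
`kerSubgroup_strictKer_kernelOfReduction_le_localKerOver`)). THEOREMS ONLY; no definition, no named fact, no instance,
no `sorry`.

* **`WeierstrassCurve.eisensteinTowerReadout_of_mem_strictKer`** — for a class `c ∈ H¹(K, T^{(k)})`
  (`T^{(k)} = E[p^{k+1}] ⊗ A_{m,k+1}(ψ⁻¹)`, `E = W_K`) whose localisation at `v ∣ p` satisfies Howard's ordinary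
  condition `F_𝔮` (the level condition of the saturated tower of strict ordinary cores), the readout of `[c] ∈ H¹(K, A_𝔮)`
  in `H¹(K_∞, E[p^∞])` lies in `(kernelOfReductionLocalDatum E p v).strictKer (ker κ)` — Greenberg's strict condition
  over `K_∞` for `C_v = E[p^∞] ∩ E₁(K̄_v)`;
* **`WeierstrassCurve.eisensteinTowerReadout_of_mem_localKerOver`** — hence, granted (CG) (`hCG`) at a place `v ∣ p` of
  good ordinary reduction ramified in `K_∞`, in `localKerOver p (ker κ) K_v`: the local condition of `Sel_{p^∞}(E/K_∞)` at
  the place above `v` (binder (B4) at `v ∣ p` of the discrete half of the shared μ-crux's `stub_controlGlue`).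

References: [Howard2004HeegnerKolyvagin] §3.1 (H¹_ord), Def. 3.2.5, Lemma 2.2.7 / Prop. 2.2.8, proof of Thm. 2.2.10;
[GreenbergLNM1716] §2 Prop. 2.2, Prop. 2.4 (pp. 73–80); [Greenberg1989] §1 p. 98 (strict condition).
BSD is not proved by any of this.
-/

noncomputable section

open scoped Classical ContRepresentation

open NumberField IsDedekindDomain Field
open Literature.NumberTheory.EllipticCurves Literature.NumberTheory.GaloisRepresentations
open Literature.NumberTheory.GaloisRepresentations.galoisCohomology
open Literature.NumberTheory.GaloisCohomology.Howard2004
open Literature.NumberTheory.EllipticCurves.GreenbergSelmer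
open IwasawaAlgebra IwasawaAlgebra.EisensteinCoeff


namespace WeierstrassCurve

open Literature.NumberTheory.EllipticCurves.ZpExtension (EisensteinLevel)

variable {K : Type} [Field K] [NumberField K] (W : WeierstrassCurve ℚ) [W.IsElliptic] {p : ℕ} [hp : Fact p.Prime]
  (κ : ZpExtension K p) {m : ℕ} (hm : 1 ≤ m)

variable (π : IwasawaAlgebra p ⧸ Ideal.span {(PowerSeries.X ^ m + PowerSeries.C (p : ℤ_[p]) : IwasawaAlgebra p)})
  (e : ℕ → ℕ)
  (hkill : letI := IwasawaAlgebra.isLocalRing_quotient_X_pow_add_C p hm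
    ∀ k, ∀ r ∈ IsLocalRing.maximalIdeal
      (IwasawaAlgebra p ⧸ Ideal.span {(PowerSeries.X ^ m + PowerSeries.C (p : ℤ_[p]) : IwasawaAlgebra p)}) ^ e k,
      ∀ x : EisensteinLevel p m (fun j ↦ geomTorsion (W.baseChange K) ((p : ℤ) ^ j)) (k + 1), r • x = 0)
  (hker : letI := IwasawaAlgebra.isLocalRing_quotient_X_pow_add_C p hm
    ∀ k, LinearMap.ker ((W.eisensteinTower (κ.unitTwist (-1)) hm).red k) =
      (IsLocalRing.maximalIdeal
        (IwasawaAlgebra p ⧸ Ideal.span {(PowerSeries.X ^ m + PowerSeries.C (p : ℤ_[p]) : IwasawaAlgebra p)}) ^ e k) •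
        (⊤ : Submodule (IwasawaAlgebra p ⧸ Ideal.span {(PowerSeries.X ^ m + PowerSeries.C (p : ℤ_[p]) : IwasawaAlgebra p)})
          (EisensteinLevel p m (fun j ↦ geomTorsion (W.baseChange K) ((p : ℤ) ^ j)) (k + 1 + 1))))
  (hπ : letI := IwasawaAlgebra.isLocalRing_quotient_X_pow_add_C p hm
    π ∈ IsLocalRing.maximalIdeal
      (IwasawaAlgebra p ⧸ Ideal.span {(PowerSeries.X ^ m + PowerSeries.C (p : ℤ_[p]) : IwasawaAlgebra p)}))
  (he : ∀ k, e k ≤ e (k + 1))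
  (hπX : π = Ideal.Quotient.mk _ PowerSeries.X) (hek : ∀ k, e (k + 1) - e k = m)

set_option maxHeartbeats 800000 in
/-- **The readout of Howard's ORDINARY condition at `v ∣ p` lies in Greenberg's STRICT condition over `K_∞`.** For a class
`c ∈ H¹(K, T^{(k)})` (`T^{(k)} = E[p^{k+1}] ⊗ A_{m,k+1}(ψ⁻¹)`) whose localisation at `v` lies in the level condition of the
saturated tower of strict ordinary cores (`F_𝔮` at `v ∣ p`, `eisensteinSelmerStructure_inr_of_mem`), the readout of
`[c] ∈ H¹(K, A_𝔮)` in `H¹(K_∞, E[p^∞])` lies in `strictKer` of the Greenberg datum `C_v = E[p^∞] ∩ E₁(K̄_v)`: its restriction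
to `Gal(K̄_v/K_{∞,w})` dies in `H¹(·, E[p^∞]/C_v)`.  (Descend the saturation exponent along the compatible local family
with `ι ∘ λ_j ∘ red = p · ι ∘ λ_{j+1}`, read the core out modulo `C_v`, and transport from `Γ_{K_v}` to `D_v ≤ Γ_K`.)
[cite: Howard2004HeegnerKolyvagin, §3.1 (H¹_ord), Def. 3.2.5 and Lemma 2.2.7 / Prop. 2.2.8] [cite: GreenbergLNM1716, §2 p. 73 (C_v, Im λ)]
[cite: Greenberg1989, §1 p. 98 (strict condition)] -/
theorem eisensteinTowerReadout_of_mem_strictKer (v : HeightOneSpectrum (𝓞 K)) (k : ℕ)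
    (c : galoisCohomology
      ((κ.unitTwist (-1)).eisensteinTwist ((W.baseChange K).torsionGaloisModule ((p : ℤ) ^ (k + 1))) hm (k + 1)) 1)
    (hc : galoisCohomology.localization
        ((κ.unitTwist (-1)).eisensteinTwist ((W.baseChange K).torsionGaloisModule ((p : ℤ) ^ (k + 1))) hm (k + 1))
        (Sum.inr v) 1 c ∈
      Tower.levelCondition
        ((κ.unitTwist (-1)).eisensteinLocalReduce (fun i ↦ (W.baseChange K).torsionGaloisModule ((p : ℤ) ^ i))
          (fun i ↦ (W.baseChange K).torsionGaloisModuleReduce p i) hm (Sum.inr v)) p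
        (fun j ↦ ((W.baseChange K).ordinaryFiltrationAt v
          (fun i ↦ (W.baseChange K).torsionGaloisModuleReduce p i) (fun _ _ ↦ rfl)).ordinaryCore
            (κ := κ.unitTwist (-1)) hm j) (k + 1)) :
    letI := IwasawaAlgebra.isLocalRing_quotient_X_pow_add_C p hm
    W.eisensteinTowerReadout κ hm π e hkill hker hπ he hπX hek
        (AddCommGroup.DirectLimit.of _ _ k c :
          AdicTower.H1A (W.eisensteinTower (κ.unitTwist (-1)) hm) π e hkill hker hπ he) ∈
      ((W.baseChange K).kernelOfReductionLocalDatum p v).strictKer κ.kerSubgroup := by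
  letI := IwasawaAlgebra.isLocalRing_quotient_X_pow_add_C p hm
  -- (1) the saturated compatible local family through `loc c`
  rw [Tower.mem_levelCondition_iff] at hc
  obtain ⟨x, hx, hxk⟩ := hc
  rw [Tower.mem_saturatedFamilies_iff] at hx
  obtain ⟨hcompat, a, ha⟩ := hx
  -- (2) the top class `p^a • x_{k+1+a}` lies in the core; (3) descend to `x_{k+1} = loc c`
  have htop := (W.baseChange K).exists_cocycle_sub_mem_plus_of_mem_ordinaryCore κ hm v
    (fun i ↦ (W.baseChange K).torsionGaloisModuleReduce p i) (fun _ _ ↦ rfl) (k + 1 + a) (p ^ a • x (k + 1 + a))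
    (ha (k + 1 + a))
  obtain ⟨η, hη, w, hw⟩ :=
    (W.baseChange K).exists_cocycle_sub_mem_plus_of_compatible κ hm v a (k + 1) x hcompat htop
  -- (4) compare with the localised cocycle `ξ ∘ res`
  obtain ⟨ξ, rfl⟩ := oneCocycleClass_surjective _ c
  obtain ⟨ξres, hξres, hξval⟩ : ∃ ξres : contOneCocycles
      (((κ.unitTwist (-1)).eisensteinTwist ((W.baseChange K).torsionGaloisModule ((p : ℤ) ^ (k + 1))) hm
        (k + 1)).toLocal (Sum.inr v : Place K)).toTopRep,
      oneCocycleClass _ ξres = galoisCohomology.localization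
        ((κ.unitTwist (-1)).eisensteinTwist ((W.baseChange K).torsionGaloisModule ((p : ℤ) ^ (k + 1))) hm (k + 1))
        (Sum.inr v) 1 (oneCocycleClass _ ξ) ∧
      ∀ τ : absoluteGaloisGroup (v.adicCompletion K), ξres.1 τ = ξ.1 (absGaloisRestrict K (v.adicCompletion K) τ) :=
    ⟨contOneCocycles.pullback (absGaloisRestrict K (Place.Completion (Sum.inr v : Place K)))
      (X := ((κ.unitTwist (-1)).eisensteinTwist ((W.baseChange K).torsionGaloisModule ((p : ℤ) ^ (k + 1))) hm
        (k + 1)).toTopRep)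
      (Y := (((κ.unitTwist (-1)).eisensteinTwist ((W.baseChange K).torsionGaloisModule ((p : ℤ) ^ (k + 1))) hm
        (k + 1)).toLocal (Sum.inr v : Place K)).toTopRep)
      (TopRep.ofHom ⟨ContinuousLinearMap.id ℤ _, fun _ ↦ rfl⟩) ξ,
     (galoisCohomology.pullback_one_oneCocycleClass _ _ ξ).symm, fun _ ↦ rfl⟩
  rw [hxk, ← hξres, ← sub_eq_zero, ← oneCocycleClass_sub, oneCocycleClass_eq_zero_iff] at hη
  obtain ⟨u, hu⟩ := hη
  have key : ∀ τ : absoluteGaloisGroup (v.adicCompletion K),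
      absGaloisRestrict K (v.adicCompletion K) τ ∈ κ.kerSubgroup →
      AddSubgroup.inclusion (AcSigned.geomTorsion_zpow_le_geomPrimaryTorsion (W.baseChange K) p (k + 1))
          (Twisted.tailReadout p hm (k + 1) ((W.baseChange K).geomTorsion_pow_nsmul_eq_zero p (k + 1))
            (ξ.1 (absGaloisRestrict K (v.adicCompletion K) τ))) -
        (absGaloisRestrict K (v.adicCompletion K) τ •
            (w - AddSubgroup.inclusion (AcSigned.geomTorsion_zpow_le_geomPrimaryTorsion (W.baseChange K) p (k + 1))
              (Twisted.tailReadout p hm (k + 1) ((W.baseChange K).geomTorsion_pow_nsmul_eq_zero p (k + 1)) u)) -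
          (w - AddSubgroup.inclusion (AcSigned.geomTorsion_zpow_le_geomPrimaryTorsion (W.baseChange K) p (k + 1))
            (Twisted.tailReadout p hm (k + 1) ((W.baseChange K).geomTorsion_pow_nsmul_eq_zero p (k + 1)) u))) ∈
        ((W.baseChange K).kernelOfReductionLocalDatum p v).plus := by
    intro τ hτ
    have h1 : ξ.1 (absGaloisRestrict K (v.adicCompletion K) τ) = η.1 τ -
        (GaloisRep.toLocal v ((κ.unitTwist (-1)).eisensteinTwist
          ((W.baseChange K).torsionGaloisModule ((p : ℤ) ^ (k + 1))) hm (k + 1)) τ u - u) := by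
      have h := hu τ
      change η.1 τ - ξres.1 τ = GaloisRep.toLocal v ((κ.unitTwist (-1)).eisensteinTwist
        ((W.baseChange K).torsionGaloisModule ((p : ℤ) ^ (k + 1))) hm (k + 1)) τ u - u at h
      rw [hξval] at h
      rw [← h, sub_sub_cancel]
    rw [h1, map_sub, map_sub, map_sub, map_sub,
      (W.baseChange K).tailReadout_toLocal_apply_of_mem_kerSubgroup κ hm v (k + 1) hτ]
    have key₀ : ∀ (a' b c' : (W.baseChange K).geomPrimaryTorsion p) (g : absoluteGaloisGroup K),
        a' - (g • b - b) - (g • (c' - b) - (c' - b)) = a' - (g • c' - c') := by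
      intro a' b c' g; rw [smul_sub]; abel
    rw [show ∀ (b : geomTorsion (W.baseChange K) ((p : ℤ) ^ (k + 1))) (g : absoluteGaloisGroup K),
        AddSubgroup.inclusion (AcSigned.geomTorsion_zpow_le_geomPrimaryTorsion (W.baseChange K) p (k + 1)) (g • b) =
          g • AddSubgroup.inclusion (AcSigned.geomTorsion_zpow_le_geomPrimaryTorsion (W.baseChange K) p (k + 1)) b from
        fun _ _ ↦ rfl, key₀]
    exact hw τ hτ
  -- (5) the readout class and the strict map on explicit cocycles
  obtain ⟨φ, hφ⟩ := (κ.unitTwist (-1)).exists_coordCocycles hm (k + 1)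
    ((κ.unitTwist (-1)).eisensteinTwistChar hm (k + 1)) ((W.baseChange K).torsionGaloisModule ((p : ℤ) ^ (k + 1)))
    (fun σ y ↦ (κ.unitTwist (-1)).eisensteinTwist_torsionGaloisModule_apply hm (k + 1) (W.baseChange K) _ σ y) κ
    (fun b ↦ (W.baseChange K).geomTorsion_pow_nsmul_eq_zero p (k + 1) b)
    (fun _ hσ ↦ κ.eisensteinTwistChar_unitTwist_eq_one_of_mem_kerSubgroup hm (k + 1) (-1) hσ) ξ
  have hlast : m - 1 < m := Nat.sub_lt (lt_of_lt_of_le zero_lt_one hm) zero_lt_one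
  rw [LocalDatum.mem_strictKer_iff, WeierstrassCurve.eisensteinTowerReadout, ZpExtension.eisensteinTowerReadout_of,
    ZpExtension.eisensteinTowerLevelMap_apply, map_zsmul,
    (κ.unitTwist (-1)).eisensteinTwistLevelReadout_oneCocycleClass hm (k + 1) _ _ _ κ _ _ ξ φ hφ, resH1Hom_oneCocycleClass]
  change ((-1 : ℤ) ^ k) • resH1Hom (decompInToH κ.kerSubgroup v) ((W.baseChange K).kernelOfReductionLocalDatum p v).grMk
    (fun _ _ ↦ rfl) (oneCocycleClass _ _) = 0
  rw [(CocycleCriteria.resH1Hom_oneCocycleClass_eq_zero_iff _ _ _ _).2, zsmul_zero]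
  refine ⟨((W.baseChange K).kernelOfReductionLocalDatum p v).grMk
    (w - AddSubgroup.inclusion (AcSigned.geomTorsion_zpow_le_geomPrimaryTorsion (W.baseChange K) p (k + 1))
      (Twisted.tailReadout p hm (k + 1) ((W.baseChange K).geomTorsion_pow_nsmul_eq_zero p (k + 1)) u)), fun y ↦ ?_⟩
  -- `y ∈ H ⊓ D_v` is `res τ` with `res τ ∈ ker κ`
  obtain ⟨τ, hτ⟩ := (mem_decomp_iff v _).1 (y : decomp (K := K) v).2
  have hτker : absGaloisRestrict K (v.adicCompletion K) τ ∈ κ.kerSubgroup := by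
    rw [hτ]; exact (mem_decompIn_iff κ.kerSubgroup v _).1 y.2
  have hval : ((decompInToH κ.kerSubgroup v y : κ.kerSubgroup) : absoluteGaloisGroup K) =
      absGaloisRestrict K (v.adicCompletion K) τ := hτ.symm
  rw [pullback_resHomOfEquivariant_apply, Subgroup.smul_def, LocalDatum.smul_grMk, ← map_sub, ← sub_eq_zero, ← map_sub,
    ← AddMonoidHom.mem_ker, LocalDatum.ker_grMk]
  change AddSubgroup.inclusion _ ((φ ⟨m - 1, hlast⟩).1 (decompInToH κ.kerSubgroup v y)) - _ ∈ _
  rw [hφ, ← ZpExtension.tailReadout_eq_tailReadout_dualFamily_last_smul hm (k + 1)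
    ((W.baseChange K).geomTorsion_pow_nsmul_eq_zero p (k + 1)), hval, ← hτ]
  exact key τ hτker

/-- **(B4) at `v ∣ p`: the readout of Howard's ordinary condition satisfies the local condition of `Sel_{p^∞}(E/K_∞)` at the
place above `v`**, granted Greenberg's Prop. 2.4 (the cite-only leaf `hCG`: strict classes over `K_∞` are Kummer) at a place
`v ∣ p` of good ordinary reduction which ramifies in `K_∞` (for the anticyclotomic tower: every `v ∣ p`,
`inertia_not_le_kerSubgroup_of_isAnticyclotomic`). [cite: GreenbergLNM1716, §2 Prop. 2.4 (pp. 79–80)]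
[cite: Howard2004HeegnerKolyvagin, §3.1 and Lemma 2.2.7 / Prop. 2.2.8] -/
theorem eisensteinTowerReadout_of_mem_localKerOver (v : HeightOneSpectrum (𝓞 K)) (hpv : ((p : ℕ) : 𝓞 K) ∈ v.asIdeal)
    (hgood : (W.baseChange K).HasGoodReductionAt v) (hord : (W.baseChange K).HasUnitRootAt v)
    (hram : ∃ 𝔓 ∈ v.primesAbove, ¬ 𝔓.inertia (absoluteGaloisGroup K) ≤ κ.kerSubgroup)
    (hCG : Greenberg1999.imKummer_eq_strictCondition_goodOrdinary_numberField) (k : ℕ)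
    (c : galoisCohomology
      ((κ.unitTwist (-1)).eisensteinTwist ((W.baseChange K).torsionGaloisModule ((p : ℤ) ^ (k + 1))) hm (k + 1)) 1)
    (hc : galoisCohomology.localization
        ((κ.unitTwist (-1)).eisensteinTwist ((W.baseChange K).torsionGaloisModule ((p : ℤ) ^ (k + 1))) hm (k + 1))
        (Sum.inr v) 1 c ∈
      Tower.levelCondition
        ((κ.unitTwist (-1)).eisensteinLocalReduce (fun i ↦ (W.baseChange K).torsionGaloisModule ((p : ℤ) ^ i))
          (fun i ↦ (W.baseChange K).torsionGaloisModuleReduce p i) hm (Sum.inr v)) p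
        (fun j ↦ ((W.baseChange K).ordinaryFiltrationAt v
          (fun i ↦ (W.baseChange K).torsionGaloisModuleReduce p i) (fun _ _ ↦ rfl)).ordinaryCore
            (κ := κ.unitTwist (-1)) hm j) (k + 1)) :
    letI := IwasawaAlgebra.isLocalRing_quotient_X_pow_add_C p hm
    W.eisensteinTowerReadout κ hm π e hkill hker hπ he hπX hek
        (AddCommGroup.DirectLimit.of _ _ k c :
          AdicTower.H1A (W.eisensteinTower (κ.unitTwist (-1)) hm) π e hkill hker hπ he) ∈
      (W.baseChange K).localKerOver p κ.kerSubgroup (v.adicCompletion K) :=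
  Greenberg1999.imKummer_eq_strictCondition_goodOrdinary_numberField.kerSubgroup_strictKer_kernelOfReduction_le_localKerOver
    (W.baseChange K) p v hpv hgood hord κ hram hCG
    (W.eisensteinTowerReadout_of_mem_strictKer κ hm π e hkill hker hπ he hπX hek v k c hc)

end WeierstrassCurve
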